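import Summits.BirchSwinnertonDyer.BirchSwinnertonDyer.Theorems.ManinLocalTwoThreeExistsMinimalOptimalDatumUnconditional
import Summits.BirchSwinnertonDyer.BirchSwinnertonDyer.Theorems.ManinLocalTwoThreeStevensNaturalTes75
import Literature.NumberTheory.EllipticCurves.PAdicLFunctionQuadraticTwistBirchProofs
import Literature.NumberTheory.EllipticCurves.NewformsTwistNewCoprimeProofs
import Literature.NumberTheory.EllipticCurves.CongruentNumberCurveIsModular
import Literature.NumberTheory.Automorphic.ShimuraCurveRibetTakahashiOptimalModularityProofs
import HarnessLib

/-!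
# Every ODD congruent number curve `E_n : y² = x³ − n²x` is modular (fact-free), and C3's / C2's hypothesis types are INHABITED at
# levels additive at BOTH `2` and `3` (`N = 32n²`, `3 ∣ n`; e.g. `N = 288`)
(route `ManinLocalTwoThree`, cruxes C3 `ManinPrimeToThreeAtNine` stmt-BirchSwinnertonDyer-22968 and C2 `ManinOddAtFour` stmt-…-22967;
cell bsd-f2-manin, prover seat p2 gen 24; `--supports stmt-BirchSwinnertonDyer-22968`)

The tree proves ONE modularity instance outright: `Tunnell1983.isNewformOf_congruentNumberCurve_one` (`E₁ : y² = x³ − x`,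
`φ = η(4z)²η(8z)² ∈ S₂(Γ₀(32))`).  Three further PROVED packages turn it into an infinite family with no printed fact:

* Shimura's twisted form `f_χ = Σ χ(n) aₙ(f) qⁿ ∈ S₂(Γ₀(N m²))` (`charTwist`, `cuspCoeff_charTwist`, Shimura 1971 Prop. 3.64) and
  **Atkin–Li 1978 Thm. 3.1, proved** (`isNewform0_charTwist_of_coprime`: the twist of a newform by a primitive quadratic character of
  conductor prime to the level is a NEWFORM of level `N m²`);
* the `L`-series of a quadratic twist (`LFunction_twist_apply_complex`: `aₙ(W^{(d)}) = χ_d(n) aₙ(W)` for `d ≡ 1 (4)` squarefree prime to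
  `N_W`, with the integer Jacobi character `exists_mulChar_int_eq_jacobiSym` and its primitive quadratic complex avatar);
* `(congruentNumberCurve 1).quadraticTwist d = congruentNumberCurve |d|` (the models agree on the nose; tree lemma `CongruentDescent.quadraticTwist_cn_one`).

Hence (§2) **`IsNewformOf (congruentNumberCurve |d|) (φ ⊗ χ_d)` at level `32 d²` for every squarefree `d ≡ 1 (mod 4)`**, i.e. for EVERY odd
squarefree `n` (take `d = ±n`): the congruent number curves `E_n`, `n` odd squarefree, are modular in the tree's `L`-version, UNCONDITIONALLY
(`exists_isNewformOf_congruentNumberCurve_of_odd`).  With Literature's fact-free datum constructor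
(`nonempty_modularParametrizationData_of_isNewformOf`) and p2's UNCONDITIONAL EXO (`ExistsMinimalOptimalDatum.existsMinimalOptimalDatum_full`,
no conductor, no modularity) this gives (§3) a LATTICE-OPTIMAL `X₀(32n²)`-datum of a GLOBALLY MINIMAL curve isogenous to `E_n` — for `3 ∣ n` a
level with `9 ∣ N` AND `4 ∣ N`: **the `∀`-domains of C3 `ManinPrimeToThreeAtNine`, of C2 `ManinOddAtFour` and of the rung are inhabited at a level
additive at `2` and at `3`** (`N = 288 = 2⁵·3²` from `E₃ : y² = x³ − 9x`), answering director (505)(W) for the `3`-adic crux as well.  §4 instantiates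
the conditional C3/C2 closers there (under {CDT, `exists_isNewformOf`}).

HONEST FRAMING: §1–§3 are unconditional kernel theorems (no named fact); §4 is CONDITIONAL on the two statement-only printed facts.  The conductor
`N(E_n) = 32n²` is NOT used or proved here (the tree has it only modulo modularity, `conductorNorm_congruentNumberCurve_of_odd`), so `BCDT.IsModular
(congruentNumberCurve n)` is not asserted; nothing here proves C2, C3, Manin's conjecture or BSD; the items stay OPEN as filed.  No definitions, no sorry.
[cite: Tunnell1983Congruent, p. 325] [cite: AtkinLi1978, §3, Thm. 3.1] [cite: Shimura1971, Prop. 3.64] [cite: SilvermanAEC2009, X.2 and Exercise 10.16]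
[cite: EdixhovenManin1991, Prop. 2] [cite: Knapp1993, Prop. 12.9(a)]
-/

set_option autoImplicit false
-- lint-debt: the directory name repeats the summit name (sibling precedent `ManinLocalTwoThreeManinOddAtFourInhabited.lean`)
set_option linter.dupNamespace false

noncomputable section

open scoped MatrixGroups ModularForm NumberTheorySymbols
open CongruenceSubgroup WeierstrassCurve Literature.NumberTheory.EllipticCurves Literature.NumberTheory.EllipticCurves.ModularForms
open Literature.NumberTheory.Automorphic
open Literature.NumberTheory.EllipticCurves.Tunnell1983

namespace Summit.BirchSwinnertonDyer.BirchSwinnertonDyer.Theorems.ManinLocalTwoThree.NonVacuity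

/-! ## §1 The models: `E₁^{(d)} = E_{|d|}` on the nose -/

/-- **`E₁^{(d)} = E_{|d|}` on the nose**, in the shape `C • W.quadraticTwist d = A` (trivial change of variables `C = 1`) consumed by the tree's
twist lemmas: the twist of `y² = x³ − x` by an integer `d` is the congruent number curve `y² = x³ − d²x` (`b₂(E₁) = b₆(E₁) = 0`, `b₄(E₁) = −2`;
the bare model identity is the tree's `Literature.Barriers.BirchSwinnertonDyer.CongruentDescent.quadraticTwist_cn_one`, re-derived inline to keep
this file's import closure inside the routinely built tree). [cite: SilvermanAEC2009, X.2] -/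
theorem one_smul_quadraticTwist_congruentNumberCurve_one (d : ℤ) :
    (1 : VariableChange ℚ) • (congruentNumberCurve 1).quadraticTwist (d : ℚ) = congruentNumberCurve d.natAbs := by
  have hd : ((d.natAbs : ℕ) : ℚ) ^ 2 = (d : ℚ) ^ 2 := by
    rw [Nat.cast_natAbs, Int.cast_abs, sq_abs]
  rw [one_smul]
  ext
  · rfl
  · simp [quadraticTwist, congruentNumberCurve, WeierstrassCurve.b₂]
  · rfl
  · simp only [quadraticTwist, congruentNumberCurve, WeierstrassCurve.b₄]
    rw [hd]; ring
  · simp [quadraticTwist, congruentNumberCurve, WeierstrassCurve.b₆]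

/-! ## §2 Modularity of the odd congruent number curves, fact-free -/

/-- **`E_{|d|}` is modular for every squarefree `d ≡ 1 (mod 4)`**: its newform is Shimura's twist `φ ⊗ χ_d ∈ S₂(Γ₀(32 d²))` of
`φ = η(4z)²η(8z)²` by the Jacobi character `χ_d = (·/|d|)` — a NEWFORM by Atkin–Li (tree theorem `isNewform0_charTwist_of_coprime`, `(32, d) = 1`)
with `aₙ(φ ⊗ χ_d) = χ_d(n) aₙ(φ) = χ_d(n) aₙ(E₁) = aₙ(E_{|d|})` (`cuspCoeff_charTwist`, `LFunction_twist_apply_complex`).  UNCONDITIONAL.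
[cite: AtkinLi1978, §3, Thm. 3.1] [cite: Shimura1971, Prop. 3.64] [cite: Tunnell1983Congruent, p. 325] -/
theorem exists_isNewformOf_congruentNumberCurve_natAbs {d : ℤ} [NeZero d.natAbs] (hd4 : d % 4 = 1) (hsq : Squarefree d) :
    ∃ F : CuspForm (Gamma0 (32 * d.natAbs ^ 2)) 2, IsNewformOf (congruentNumberCurve d.natAbs) F := by
  have hodd : Odd d.natAbs := Int.natAbs_odd.mpr (Int.odd_iff.mpr (by omega))
  have hsqn : Squarefree d.natAbs := Int.squarefree_natAbs.mpr hsq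
  -- the Jacobi character mod `|d|` and its primitive quadratic complex avatar
  obtain ⟨χ, hχ⟩ := exists_mulChar_int_eq_jacobiSym d.natAbs
  obtain ⟨hq, hprim⟩ := mulChar_jacobi_complex_isQuadratic_isPrimitive hχ hodd hsqn
  -- `(32, |d|) = 1`
  have hcopN : (32 : ℕ).Coprime d.natAbs := by
    have h2 : Nat.Coprime 2 d.natAbs := (Nat.Prime.coprime_iff_not_dvd Nat.prime_two).mpr hodd.not_two_dvd_nat
    simpa using h2.pow_left 5
  have hcop : IsCoprime d ((congruentNumberCurve 1).conductorNorm ℤ : ℤ) := by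
    rw [conductorNorm_congruentNumberCurve_one, Int.isCoprime_iff_gcd_eq_one, Int.gcd_eq_natAbs, Int.natAbs_natCast]
    exact hcopN.symm
  haveI := isElliptic_congruentNumberCurve_one
  refine ⟨charTwist (32 * d.natAbs ^ 2) (dvd_mul_right 32 (d.natAbs ^ 2)) (dvd_mul_left (d.natAbs ^ 2) 32) hq congruentCuspForm32,
    isNewform0_charTwist_of_coprime hq hprim hcopN isNewform0_congruentCuspForm32, fun n ↦ ?_⟩
  rw [cuspCoeff_charTwist _ _ _ hq hprim congruentCuspForm32 n, cuspCoeff_congruentCuspForm32_eq_lFunction n,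
    LFunction_twist_apply_complex (congruentNumberCurve 1) hd4 hsq hcop (one_smul_quadraticTwist_congruentNumberCurve_one d) hχ n]

/-- **Every ODD squarefree congruent number curve `E_n : y² = x³ − n²x` is modular** (newform at level `32 n²`), UNCONDITIONALLY: take
`d = n` if `n ≡ 1 (mod 4)` and `d = −n` if `n ≡ 3 (mod 4)` in the previous theorem. [cite: AtkinLi1978, §3, Thm. 3.1] [cite: Tunnell1983Congruent, p. 325] -/
theorem exists_isNewformOf_congruentNumberCurve_of_odd {n : ℕ} [NeZero n] (hodd : Odd n) (hsq : Squarefree n) :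
    ∃ F : CuspForm (Gamma0 (32 * n ^ 2)) 2, IsNewformOf (congruentNumberCurve n) F := by
  -- `d = n` if `n ≡ 1 (mod 4)`, `d = −n` if `n ≡ 3 (mod 4)`; in both cases `|d| = n`
  obtain ⟨d, hd4, hdn⟩ : ∃ d : ℤ, d % 4 = 1 ∧ d.natAbs = n := by
    obtain ⟨k, hk⟩ := hodd
    rcases Nat.even_or_odd k with ⟨j, hj⟩ | ⟨j, hj⟩
    · exact ⟨(n : ℤ), by omega, Int.natAbs_natCast n⟩
    · exact ⟨-(n : ℤ), by omega, by rw [Int.natAbs_neg, Int.natAbs_natCast]⟩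
  subst hdn
  exact exists_isNewformOf_congruentNumberCurve_natAbs hd4 (Int.squarefree_natAbs.mp hsq)

/-- In particular **`E₃ : y² = x³ − 9x` is modular**, with a newform at level `288 = 2⁵·3²`.  UNCONDITIONAL. [cite: AtkinLi1978, §3, Thm. 3.1] -/
theorem exists_isNewformOf_congruentNumberCurve_three :
    ∃ F : CuspForm (Gamma0 288) 2, IsNewformOf (congruentNumberCurve 3) F :=
  exists_isNewformOf_congruentNumberCurve_of_odd (n := 3) (by decide) Nat.prime_three.prime.squarefree

/-! ## §3 Non-vacuity at levels additive at `2` AND `3` -/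

/-- **A lattice-optimal `X₀(32n²)`-datum of a GLOBALLY MINIMAL curve isogenous to `E_n` exists for every odd squarefree `n`** (fact-free:
§2 + Literature `nonempty_modularParametrizationData_of_isNewformOf` + p2's unconditional EXO `existsMinimalOptimalDatum_full`; no conductor is computed).
[cite: EdixhovenManin1991, Prop. 2] [cite: Knapp1993, Prop. 12.9(a)] -/
theorem exists_latticeOptimalDatum_congruent {n : ℕ} [NeZero n] (hodd : Odd n) (hsq : Squarefree n) :
    ∃ (W₀ : WeierstrassCurve ℚ) (_ : W₀.IsElliptic) (_ : W₀.IsGloballyMinimal) (D₀ : ModularParametrizationData W₀ (32 * n ^ 2)),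
      (congruentNumberCurve n).IsIsogenous W₀ ∧ ∀ z ∈ D₀.L.lattice, ∃ w ∈ periodLattice D₀.f, z = D₀.c * w := by
  haveI : (congruentNumberCurve n).IsElliptic := isElliptic_congruentNumberCurve (NeZero.ne n)
  obtain ⟨F, hF⟩ := exists_isNewformOf_congruentNumberCurve_of_odd hodd hsq
  obtain ⟨D⟩ := nonempty_modularParametrizationData_of_isNewformOf hF
  obtain ⟨W₀, h₀, hmin, D₀, -, hiso, hopt, -⟩ := ExistsMinimalOptimalDatum.existsMinimalOptimalDatum_full (congruentNumberCurve n) D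
  exact ⟨W₀, h₀, hmin, D₀, hiso, hopt⟩

/-- **The witness at `N = 288 = 2⁵·3²`** (from `E₃ : y² = x³ − 9x`): a lattice-optimal `X₀(288)`-datum of a globally minimal curve.  UNCONDITIONAL.
[cite: EdixhovenManin1991, Prop. 2] [cite: AtkinLi1978, §3, Thm. 3.1] -/
theorem exists_latticeOptimalDatum_twoEightyEight :
    ∃ (W₀ : WeierstrassCurve ℚ) (_ : W₀.IsElliptic) (_ : W₀.IsGloballyMinimal) (D₀ : ModularParametrizationData W₀ 288),
      (congruentNumberCurve 3).IsIsogenous W₀ ∧ ∀ z ∈ D₀.L.lattice, ∃ w ∈ periodLattice D₀.f, z = D₀.c * w :=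
  exists_latticeOptimalDatum_congruent (n := 3) (by decide) Nat.prime_three.prime.squarefree

/-- **C3's `∀`-domain is inhabited**: there are a globally minimal elliptic `W/ℚ`, a level `N` with `3² ∣ N` and an `X₀(N)`-datum of `W` satisfying
the lattice clause — literally the binder block of `Theses.ManinLocalTwoThree.ManinPrimeToThreeAtNine` after its four fact hypotheses (`N = 288`).
UNCONDITIONAL. [cite: AtkinLi1978, §3, Thm. 3.1] [cite: EdixhovenManin1991, Prop. 2] -/
theorem maninPrimeToThreeAtNine_domain_inhabited :
    ∃ (W : WeierstrassCurve ℚ) (_ : W.IsElliptic) (_ : W.IsGloballyMinimal) (N : ℕ) (_ : NeZero N) (D : ModularParametrizationData W N),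
      (∀ z ∈ D.L.lattice, ∃ w ∈ periodLattice D.f, z = D.c * w) ∧ 3 ^ 2 ∣ N := by
  obtain ⟨W₀, hE₀, hM₀, D₀, -, hopt⟩ := exists_latticeOptimalDatum_twoEightyEight
  exact ⟨W₀, hE₀, hM₀, 288, inferInstance, D₀, hopt, by norm_num⟩

/-- **One datum in the domains of C2, C3 and the rung simultaneously**: level `288` is divisible by `2²` and `3²`.  UNCONDITIONAL.
[cite: AtkinLi1978, §3, Thm. 3.1] [cite: EdixhovenManin1991, Prop. 2] -/
theorem maninLocalTwoThree_domains_inhabited :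
    ∃ (W : WeierstrassCurve ℚ) (_ : W.IsElliptic) (_ : W.IsGloballyMinimal) (N : ℕ) (_ : NeZero N) (D : ModularParametrizationData W N),
      (∀ z ∈ D.L.lattice, ∃ w ∈ periodLattice D.f, z = D.c * w) ∧ 2 ^ 2 ∣ N ∧ 3 ^ 2 ∣ N := by
  obtain ⟨W₀, hE₀, hM₀, D₀, -, hopt⟩ := exists_latticeOptimalDatum_twoEightyEight
  exact ⟨W₀, hE₀, hM₀, 288, inferInstance, D₀, hopt, by norm_num, by norm_num⟩

/-! ## §4 The conditional closers at the inhabited point -/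

/-- **Under {CDT, modularity} every lattice-optimal `X₀(288)`-datum of a globally minimal curve has `|c₀| = 1`** — in particular `3 ∤ c₀`
(C3's conclusion shape) and `2 ∤ c₀` (C2's) — the LEAD's conditional leaf `Theorems.maninLocalTwoThree_maninConstantOne_of_CDT_of_modularity` at
the inhabited level `288`.  CONDITIONAL on the two statement-only printed facts; nothing is computed unconditionally.
[cite: CalegariDimitrovTang2025, Thm. 1] [cite: DiamondShurman2005, Thm. 8.8.3] -/
theorem not_three_dvd_and_not_two_dvd_maninConstant_twoEightyEight_of_CDT_of_modularity
    (hCDT : CalegariDimitrovTang2025_unboundedDenominators) (hnf : exists_isNewformOf)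
    (W₀ : WeierstrassCurve ℚ) [W₀.IsElliptic] [W₀.IsGloballyMinimal] (D₀ : ModularParametrizationData W₀ 288)
    (hopt : ∀ z ∈ D₀.L.lattice, ∃ w ∈ periodLattice D₀.f, z = D₀.c * w) :
    ¬ (3 : ℤ) ∣ D₀.maninConstant ∧ ¬ (2 : ℤ) ∣ D₀.maninConstant := by
  have h1 := Theorems.maninLocalTwoThree_maninConstantOne_of_CDT_of_modularity hCDT hnf W₀ D₀ hopt
  constructor <;>
  · intro h
    have h' := (dvd_abs _ _).mpr h
    rw [h1] at h'
    exact absurd (Int.le_of_dvd one_pos h') (by norm_num)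

/-- **The inhabited instance of the conditional rows**: under {CDT, modularity} the §3 witness datum at level `288` has Manin constant `±1`.
CONDITIONAL. [cite: CalegariDimitrovTang2025, Thm. 1] [cite: DiamondShurman2005, Thm. 8.8.3] -/
theorem exists_datum_twoEightyEight_abs_maninConstant_eq_one_of_CDT_of_modularity
    (hCDT : CalegariDimitrovTang2025_unboundedDenominators) (hnf : exists_isNewformOf) :
    ∃ (W₀ : WeierstrassCurve ℚ) (_ : W₀.IsElliptic) (_ : W₀.IsGloballyMinimal) (D₀ : ModularParametrizationData W₀ 288),
      (congruentNumberCurve 3).IsIsogenous W₀ ∧ (∀ z ∈ D₀.L.lattice, ∃ w ∈ periodLattice D₀.f, z = D₀.c * w) ∧ |D₀.maninConstant| = 1 := by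
  obtain ⟨W₀, hE₀, hM₀, D₀, hiso, hopt⟩ := exists_latticeOptimalDatum_twoEightyEight
  haveI := hE₀; haveI := hM₀
  exact ⟨W₀, hE₀, hM₀, D₀, hiso, hopt, Theorems.maninLocalTwoThree_maninConstantOne_of_CDT_of_modularity hCDT hnf W₀ D₀ hopt⟩

end Summit.BirchSwinnertonDyer.BirchSwinnertonDyer.Theorems.ManinLocalTwoThree.NonVacuity

end
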